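import Summits.NavierStokesRegularity.NavierStokesRegularity.Theses.HardyPointSink
import Summits.NavierStokesRegularity.NavierStokesRegularity.Theorems.HardyPointSinkHardyEnergyBoundAxisTransfer
import Literature.Analysis.FluidPDE.Seregin2020AxisymmetricTypeII
import HarnessLib

/-!
# Route HardyPointSink — crux `HardyEnergyBound` (item stmt-NavierStokesRegularity-7979):
# the Hardy bound forces scaled-energy Type I at every point (no Type II blow-up in Seregin's sense)

Support file (theorems only, `--supports stmt-NavierStokesRegularity-7979`; lead c5 of the crux
line, 2026-08-17).  The crux `C2 = Theses.HardyPointSink.HardyEnergyBound` bounds the local Hardy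
energy `∫_{B(xs,r₀)} |u(t,x)|²/|x − x₀| dx ≤ K` of every Kato solution from Clay data near every
centre `xs`, for sinks `x₀ ∈ B(xs, r₀)` and `T − r₀² < t < T`.  Read at the single sink `x₀ = xs`
it dominates the CKN scaled energy `A(r) = sup_{T−r²<t<T} r⁻¹ ∫_{B_r(xs)} |u(t)|²` at EVERY scale
`0 < r ≤ min (r₀, √T)` (`r⁻¹ ≤ |x − xs|⁻¹` on `B_r(xs)`; CKN 1982 §2), so:

* `hardyEnergyBound_cknA_le` — under C2, `cknA r (T, xs) u ≤ K` for all small `r`, hence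
  `limsup_{r→0} A(r) ≤ K < ∞` (`hardyEnergyBound_limsup_cknA_lt_top`);
* `hardyEnergyBound_blowupIndex_lt_top` — Seregin's blow-up index
  `g(T, xs) = min (limsup E, limsup A, limsup C)` (Seregin 2020, Def. 1.7; tree
  `Seregin2020.blowupIndex`) is finite at every point, for every weak gradient `G`;
* `hardyEnergyBound_not_isTypeIIAt` — **under C2 no Kato solution from Clay data has a Type II
  singular point in Seregin's sense** (`Seregin2020.IsTypeIIAt`), at any time `T` of its life span
  and any centre: every blow-up C2 allows is scaled-energy Type I (and then ℓ¹-summable over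
  dyadic scales, p159280).  This is the currency in which Type I exclusions are printed
  (axisymmetric: Seregin 2020 Thm 2.1, giving `C2 ⇒ AxisymmetricSwirlRegularity`,
  `HardyPointSinkHardyEnergyBoundAxisymmetric.lean`; pointwise-rate versions: KNSS 2009,
  Seregin–Šverák 2009), and the form a Type-II blow-up scenario must take to refute C2.

References: L. Caffarelli, R. Kohn, L. Nirenberg, Comm. Pure Appl. Math. 35 (1982), §2 [CKN1982];
G. Seregin, Anal. Math. Phys. 10 (2020), Paper 46, Def. 1.7 [Seregin2020]; G. Seregin, Comm. PDE 37
(2012) / arXiv:1104.3615 (Type II and critical norms) [Seregin2012].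
-/

noncomputable section

-- the summit and its single sub-problem share the name (CONVENTIONS §1), as in every Theorems file
set_option linter.dupNamespace false

open Set MeasureTheory Filter Topology Function Metric Module Literature.Analysis.FluidPDE
open scoped ENNReal NNReal

namespace Summit.NavierStokesRegularity.NavierStokesRegularity.Theorems

/-- **The single-centre Hardy bound dominates the scaled energy at every small scale.**  If
`∫_{B(xs,r₀)} |u(t,x)|²/|x − xs| dx ≤ K` for all `t ∈ [0, T)` with `T − r₀² < t`, then
`A(r) = sup_{T−r²<t<T} r⁻¹ ∫_{B_r(xs)} |u(t)|² ≤ K` for every `0 < r ≤ r₀` with `r² ≤ T`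
(`|u|² ≤ r · |u|²/|x − xs|` on `B_r(xs)`, `B_r ⊆ B_{r₀}`). [cite: CaffarelliKohnNirenberg1982, §2] -/
theorem hardyEnergyBound_cknA_le {u : ℝ → EuclideanSpace ℝ (Fin 3) → EuclideanSpace ℝ (Fin 3)}
    {T r₀ : ℝ} {xs : EuclideanSpace ℝ (Fin 3)} {K : ℝ≥0}
    (hH : ∀ t ∈ Ico 0 T, T - r₀ ^ 2 < t → ∫⁻ x in ball xs r₀, ‖u t x‖ₑ ^ 2 / ‖x - xs‖ₑ ≤ K)
    {r : ℝ} (hr : 0 < r) (hrr₀ : r ≤ r₀) (hrT : r ^ 2 ≤ T) :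
    cknA r ((T, xs) : ℝ × EuclideanSpace ℝ (Fin 3)) u ≤ K := by
  unfold cknA
  refine iSup₂_le fun t ht => ?_
  change t ∈ Ioo (T - r ^ 2) T at ht
  have hr2 : r ^ 2 ≤ r₀ ^ 2 := pow_le_pow_left₀ hr.le hrr₀ 2
  have hHt := hH t ⟨by linarith [ht.1], ht.2⟩ (by linarith [ht.1])
  have hr0 : ENNReal.ofReal r ≠ 0 := (ENNReal.ofReal_pos.2 hr).ne'
  have hrtop : ENNReal.ofReal r ≠ ∞ := ENNReal.ofReal_ne_top
  -- pointwise on `B_r(xs)`: `|u|² ≤ r · |u|² / |x - xs|`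
  have hpt : ∀ x ∈ ball xs r,
      ‖u t x‖ₑ ^ 2 ≤ ENNReal.ofReal r * (‖u t x‖ₑ ^ 2 / ‖x - xs‖ₑ) := by
    intro x hx
    have hdist : ‖x - xs‖ₑ ≤ ENNReal.ofReal r := by
      rw [← ofReal_norm, ← dist_eq_norm]
      exact ENNReal.ofReal_le_ofReal (le_of_lt (mem_ball.1 hx))
    exact hardyEnergyBound_le_mul_div hdist hr0 hrtop
  have hint : ∫⁻ x in ball xs r, ‖u t x‖ₑ ^ 2 ≤ ENNReal.ofReal r * K := by
    calc ∫⁻ x in ball xs r, ‖u t x‖ₑ ^ 2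
        ≤ ∫⁻ x in ball xs r, ENNReal.ofReal r * (‖u t x‖ₑ ^ 2 / ‖x - xs‖ₑ) :=
          setLIntegral_mono' measurableSet_ball hpt
      _ = ENNReal.ofReal r * ∫⁻ x in ball xs r, ‖u t x‖ₑ ^ 2 / ‖x - xs‖ₑ :=
          lintegral_const_mul' _ _ hrtop
      _ ≤ ENNReal.ofReal r * ∫⁻ x in ball xs r₀, ‖u t x‖ₑ ^ 2 / ‖x - xs‖ₑ :=
          mul_le_mul_right (lintegral_mono_set (ball_subset_ball hrr₀)) _
      _ ≤ ENNReal.ofReal r * K := mul_le_mul_right hHt _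
  calc (ENNReal.ofReal r)⁻¹ * ∫⁻ x in ball ((T, xs) : ℝ × EuclideanSpace ℝ (Fin 3)).2 r, ‖u t x‖ₑ ^ 2
      ≤ (ENNReal.ofReal r)⁻¹ * (ENNReal.ofReal r * K) := mul_le_mul_right hint _
    _ = K := by rw [← mul_assoc, ENNReal.inv_mul_cancel hr0 hrtop, one_mul]

/-- **Under the single-centre Hardy bound, `limsup_{r→0} A(r) ≤ K < ∞`.** [cite: CaffarelliKohnNirenberg1982, §2] -/
theorem hardyEnergyBound_limsup_cknA_lt_top
    {u : ℝ → EuclideanSpace ℝ (Fin 3) → EuclideanSpace ℝ (Fin 3)} {T r₀ : ℝ}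
    {xs : EuclideanSpace ℝ (Fin 3)} {K : ℝ≥0} (hT : 0 < T) (hr₀ : 0 < r₀)
    (hH : ∀ t ∈ Ico 0 T, T - r₀ ^ 2 < t → ∫⁻ x in ball xs r₀, ‖u t x‖ₑ ^ 2 / ‖x - xs‖ₑ ≤ K) :
    limsup (fun r => cknA r ((T, xs) : ℝ × EuclideanSpace ℝ (Fin 3)) u) (𝓝[>] 0) < ∞ := by
  -- the admissible scales `0 < r < ρ = min (r₀, √T)` form a neighbourhood of `0⁺`
  set ρ : ℝ := min r₀ (Real.sqrt T) with hρ
  have hρpos : 0 < ρ := lt_min hr₀ (Real.sqrt_pos.2 hT)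
  have hbound : ∀ᶠ r in 𝓝[>] (0 : ℝ),
      cknA r ((T, xs) : ℝ × EuclideanSpace ℝ (Fin 3)) u ≤ K := by
    filter_upwards [Ioo_mem_nhdsGT hρpos] with r hr
    have hrr₀ : r ≤ r₀ := hr.2.le.trans (min_le_left _ _)
    have hrT : r ^ 2 ≤ T := by
      have h1 : r ≤ Real.sqrt T := hr.2.le.trans (min_le_right _ _)
      have h2 := pow_le_pow_left₀ hr.1.le h1 2
      rwa [Real.sq_sqrt hT.le] at h2
    exact hardyEnergyBound_cknA_le hH hr.1 hrr₀ hrT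
  exact (limsup_le_of_le (by isBoundedDefault) hbound).trans_lt ENNReal.coe_lt_top

/-- **Under C2, Seregin's blow-up index is finite at every point of every Kato solution from Clay
data**: `g(T, xs) ≤ limsup A < ∞` for every weak gradient `G` (`Seregin2020.blowupIndex`, Def. 1.7).
[cite: Seregin2020, Def. 1.7] -/
theorem hardyEnergyBound_blowupIndex_lt_top (hC2 : Theses.HardyPointSink.HardyEnergyBound)
    {ν : ℝ} (hν : 0 < ν) {u₀ : EuclideanSpace ℝ (Fin 3) → EuclideanSpace ℝ (Fin 3)}
    (hsm : ContDiff ℝ (⊤ : ℕ∞) u₀) (hdiv : NSWave0.IsDivFree u₀) (hdec : HasRapidSpatialDecay u₀)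
    {T : ℝ} {u : ℝ → EuclideanSpace ℝ (Fin 3) → EuclideanSpace ℝ (Fin 3)} (hT : 0 < T)
    (hu : IsKatoSolutionOn T ν u₀ u) (xs : EuclideanSpace ℝ (Fin 3))
    (G : ℝ → EuclideanSpace ℝ (Fin 3) → EuclideanSpace ℝ (Fin 3) →L[ℝ] EuclideanSpace ℝ (Fin 3)) :
    Seregin2020.blowupIndex ((T, xs) : ℝ × EuclideanSpace ℝ (Fin 3)) u G < ∞ := by
  obtain ⟨r₀, hr₀, K, hK⟩ := hC2 ν hν u₀ hsm hdiv hdec T u hT hu xs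
  exact (Seregin2020.blowupIndex_le_limsup_cknA _ u G).trans_lt
    (hardyEnergyBound_limsup_cknA_lt_top hT hr₀ fun t ht hlt => hK xs (mem_ball_self hr₀) t ht hlt)

/-- **`HardyEnergyBound` excludes Type II blow-up in Seregin's sense, everywhere.**  Under C2, no
Kato solution on `[0, T)` from a smooth, divergence-free, rapidly decaying datum has a Type II
singular point `(T, xs)` (Seregin 2020, Def. 1.7: backward singular point with blow-up index
`g = ∞`), for any centre `xs` and any weak gradient `G`: every singularity C2 allows is
scaled-energy Type I.  (The axisymmetric case, where Seregin 2020 Thm 2.1 makes every singular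
point Type II, is `axisymmetricSwirlRegularity_of_hardyEnergyBound`.) [cite: Seregin2020, Def. 1.7] -/
theorem hardyEnergyBound_not_isTypeIIAt :
    Summit.NavierStokesRegularity.NavierStokesRegularity.Theses.HardyPointSink.HardyEnergyBound →
    ∀ ν : ℝ, 0 < ν → ∀ u₀ : EuclideanSpace ℝ (Fin 3) → EuclideanSpace ℝ (Fin 3),
      ContDiff ℝ (⊤ : ℕ∞) u₀ → Literature.Analysis.FluidPDE.NSWave0.IsDivFree u₀ →
      Literature.Analysis.FluidPDE.HasRapidSpatialDecay u₀ →
      ∀ (T : ℝ) (u : ℝ → EuclideanSpace ℝ (Fin 3) → EuclideanSpace ℝ (Fin 3)), 0 < T →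
      Literature.Analysis.FluidPDE.IsKatoSolutionOn T ν u₀ u →
      ∀ (xs : EuclideanSpace ℝ (Fin 3))
        (G : ℝ → EuclideanSpace ℝ (Fin 3) → EuclideanSpace ℝ (Fin 3) →L[ℝ] EuclideanSpace ℝ (Fin 3)),
      ¬ Literature.Analysis.FluidPDE.Seregin2020.IsTypeIIAt ((T, xs) : ℝ × EuclideanSpace ℝ (Fin 3)) u G := by
  intro hC2 ν hν u₀ hsm hdiv hdec T u hT hu xs G hII
  exact (hardyEnergyBound_blowupIndex_lt_top hC2 hν hsm hdiv hdec hT hu xs G).ne hII.2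

end Summit.NavierStokesRegularity.NavierStokesRegularity.Theorems

end
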